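import Mathlib.Tactic
import HarnessLib
import HarnessLib.Audit.Tags
import Summits.CriticalPhenomena.PercolationContinuityZ3.Theorems.PercNearOneGluingNoHeavyLowerTailSahiRainbowMaxPrivate
import Summits.CriticalPhenomena.PercolationContinuityZ3.Theorems.PercNearOneGluingNoHeavyLowerTailSahiRainbowMaxHardGeneric

/-!
# The max-antichain accounting: PEELABLE hard sets — an unconditional certificate for the rainbow lemma

Support file (seat `prim-masterthm-p1`, gen 39; `--supports stmt-CriticalPhenomena-4575`).  One inductive predicate (a certificate format) and
unconditional theorems; no `sorry`, standard axioms.  Memo `run/shared/lean/prim/prim-masterthm/FROM-prim-masterthm-p1-g39-MAX-ACCOUNTING.md` §10.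

SETTING (`…SahiRainbowMax`, `…Private`, `…HardGeneric`): `availColours F A X`, private colours (`card_availColours_erase_lt`), and the fact
that the own colours `rainbowMeets F Y` of a sub-antichain pay for `Y` (`card_le_card_rainbowMeets_of_antichain`, gen 38).

NEW HERE ([this work], gen 39).  `Peelable F A Y` is the smallest predicate such that (empty) `∅` is peelable,
* (base) `Y` is peelable if all its own colours are available to it (`rainbowMeets F Y ⊆ availColours F A Y`), and
* (peel) `Y` is peelable if some `y ∈ Y` owns a PRIVATE available colour (strictly inside `y`, inside no other member of `Y`) and `Y.erase y` is peelable.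
THEOREMS (unconditional):
* `card_le_card_availColours_of_peelable`: a peelable admissible `X ⊆ A` satisfies the Hall inequality `#X ≤ #availColours F A X`;
* **`card_le_card_rainbowMeets_of_peelable`**: if the hard members of a complement-free family `P` are peelable (in the maximal antichain), then
  `#P ≤ #rainbowMeets F P`; `…_of_peelable_compl`: the same for the complemented family.
REACH (engine `prim-masterthm-p1/code-g39/c/coverage3.c`): the hard set of `P` or of its complemented family is peelable for EVERY complement-free
family of `2^4` (6 560) and of `2^5` (43 046 720) — so on at most five points the rainbow lemma now follows from these two theorems by exhibiting a
peeling (a structural certificate, no `decide`).  Non-peelable admissible pairs exist from six points on (private-free `X = {13,23,14,24}` with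
cojoin-swallowing outsiders); the general case is `AntichainPrivateFreeHall`.
HONEST FRAMING: unconditional; `RainbowMeetCojoin` in general remains OPEN. [this work]
-/

namespace Summit.CriticalPhenomena.PercolationContinuityZ3.Theorems.SahiColouredDaykin

open Finset

variable {α : Type*} [DecidableEq α]

/-- **Peelable sub-families** (a certificate format): `Y` is peelable in `(F, A)` if its own rainbow meets are all available to it, or if some
member owns a private available colour and the rest is peelable. [this work] -/
inductive Peelable (F : Finset α) (A : Finset (Finset α)) : Finset (Finset α) → Prop
  | empty : Peelable F A ∅
  | base {Y : Finset (Finset α)} (h : rainbowMeets F Y ⊆ availColours F A Y) : Peelable F A Y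
  | peel {Y : Finset (Finset α)} {y t : Finset α} (hy : y ∈ Y) (ht : t ∈ availColours F A Y) (hty : t ⊂ y)
      (hpriv : ∀ y' ∈ Y, y' ≠ y → ¬ t ⊂ y') (hrest : Peelable F A (Y.erase y)) : Peelable F A Y

section Peel

variable {F : Finset α} {A : Finset (Finset α)}

/-- **A peelable admissible sub-family satisfies the Hall inequality.** [this work] -/
theorem card_le_card_availColours_of_peelable (hAF : ∀ a ∈ A, a ⊆ F) (hcf : ∀ a ∈ A, F \ a ∉ A)
    (hanti : IsAntichain (· ⊆ ·) (A : Set (Finset α))) {X : Finset (Finset α)} (hpeel : Peelable F A X) :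
    X ⊆ A → #X ≤ #(availColours F A X) := by
  induction hpeel with
  | empty => intro _; rw [card_empty]; exact Nat.zero_le _
  | @base Y h =>
    intro hYA
    have hYF : ∀ S ∈ Y, S ⊆ F := fun S hS => hAF S (hYA hS)
    have hYcf : ∀ S ∈ Y, F \ S ∉ Y := fun S hS h' => hcf S (hYA hS) (hYA h')
    have hYanti : IsAntichain (· ⊆ ·) (Y : Set (Finset α)) := hanti.subset (coe_subset.2 hYA)
    exact (card_le_card_rainbowMeets_of_antichain F Y hYF hYcf hYanti).trans (card_le_card h)
  | @peel Y y t hy ht hty hpriv _ ih =>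
    intro hYA
    have hlt := card_availColours_erase_lt (X := Y) (hYA hy) ht hty hpriv
    have hrest := ih ((erase_subset y Y).trans hYA)
    have hcard : #(Y.erase y) + 1 = #Y := card_erase_add_one hy
    omega

/-- **The rainbow lemma for families with a peelable hard set** (unconditional). [this work] -/
theorem card_le_card_rainbowMeets_of_peelable {P : Finset (Finset α)} (hPF : ∀ S ∈ P, S ⊆ F) (hcf : ∀ S ∈ P, F \ S ∉ P)
    (hpeel : Peelable F (maxMembers P) (hardMembers F P)) : #P ≤ #(rainbowMeets F P) := by
  have hAP := maxMembers_subset P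
  exact card_le_card_rainbowMeets_of_avail hPF hcf
    (card_le_card_availColours_of_peelable (fun a ha => hPF a (hAP ha)) (fun a ha h' => hcf a (hAP ha) (hAP h'))
      (isAntichain_maxMembers P) hpeel (hardMembers_subset F P))

/-- The min-antichain twin: a peelable hard set of the complemented family suffices. [this work] -/
theorem card_le_card_rainbowMeets_of_peelable_compl {P : Finset (Finset α)} (hPF : ∀ S ∈ P, S ⊆ F) (hcf : ∀ S ∈ P, F \ S ∉ P)
    (hpeel : Peelable F (maxMembers (P.image (F \ ·))) (hardMembers F (P.image (F \ ·)))) : #P ≤ #(rainbowMeets F P) :=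
  card_le_card_rainbowMeets_of_image_compl hPF
    (card_le_card_rainbowMeets_of_peelable subset_of_mem_image_compl (image_compl_complFree hPF hcf) hpeel)

/-- Hard-generic position is the base case of peelability. [this work] -/
theorem peelable_of_hard_generic {X : Finset (Finset α)} (hAF : ∀ a ∈ A, a ⊆ F) (hanti : IsAntichain (· ⊆ ·) (A : Set (Finset α)))
    (hXA : X ⊆ A) (hX : ∀ x ∈ X, F \ x ∉ rainbowMeets F A)
    (hB : ∀ x ∈ X, ∀ y ∈ X, x ≠ y → F \ (x ∩ y) ∉ A)
    (hS : ∀ x ∈ X, ∀ y ∈ X, x ≠ y → ∀ a ∈ A, F \ (x ∪ y) ⊂ a → a ∈ X) : Peelable F A X := by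
  rcases X.eq_empty_or_nonempty with hX0 | hXne
  · subst hX0; exact Peelable.empty
  · exact Peelable.base (rainbowMeets_subset_availColours_of_hard_generic hAF hanti hXA hX hXne hB hS)

end Peel

end Summit.CriticalPhenomena.PercolationContinuityZ3.Theorems.SahiColouredDaykin
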